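import Summits.ResolutionOfSingularities.ResolutionOfSingularities.Theorems.MarkedTransferCampaignW46ThreefoldsTauTwoSlice
import Summits.ResolutionOfSingularities.ResolutionOfSingularities.Theorems.MarkedTransferCampaignW46ThreefoldsHostTauThreeSlice
import Summits.ResolutionOfSingularities.ResolutionOfSingularities.Theorems.MarkedTransferCampaignW46ThreefoldsHostPowers
import Literature.AlgebraicGeometry.Resolution.BlowupSNC
import Literature.AlgebraicGeometry.Resolution.AlterationsNormalFormCentreFormalIdeal
import Literature.AlgebraicGeometry.Resolution.WeakJacobianMizutaniProof
import HarnessLib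

/-!
# [OURS · L1 W4.6 rung (ii-τ2)] THE ISOLATED `τ ≥ 2` POINT OF THE HOST ITEM — stmt-16156's literal conclusion
# (`IsMarkedResolution ⟨I, E, m⟩`, ANY simple-normal-crossings boundary `E`) for inputs whose order-`m` locus is ONE closed
# threefold point with `τ ≥ 2`, PROVED (successive B-permissible point blow-ups; termination kernel-checked)

Cell res-hironaka, LADDER-RESOLUTION rung L (D-0089), slot W4.6, rung (ii) (threefold hypersurfaces); seat res-L1-s46-pv-3
(gen 4). Host route MarkedTransfer, host item `HypersurfaceOrderReductionDimLeThree` (stmt-ResolutionOfSingularities-16156);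
filed `--supports` it `--as helper`. OURS scheme theory over PROVED tree lemmas (Cossart–Piltant 2008 §4: Lemma 4.3 (1), (3),
the `τ = 2` termination of Prop. 4.4 `false_of_nearChain_tau_two`; BGMW boundary bookkeeping `MarkedIdeal.hasSNC_transform_boundary`);
nothing of H. Hironaka's manuscript is asserted; the route file is NOT imported (the host's binders are copied verbatim).
AI-written; AI review is weaker than expert review. Host-shape twin of `…ThreefoldsTauTwoSlice.lean` (p515229), for ONE bad point
(the host currency has no patching lemma yet; several far-apart bad points are the Γ-free file's business).

## What is proved (one proof-device structure, no OURS statement)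

* `CampaignW46.hasSNCWith_vanishingIdeal_singleton_of_hasSNC` — a closed point is a B-permissible centre for every
  simple-normal-crossings boundary (the singleton case of p510668's finite-set lemma).
* `CampaignW46.HostTauTwoChainState` — PROOF DEVICE (not an OURS notion): a stage of the chain of B-permissible point blow-ups
  over an isolated `τ ≥ 2` point, in BGMW currency (`IsMultipleBlowup` from `⟨J₀, E₀, m⟩`, current boundary with simple normal
  crossings, the single bad point with `ord = m`, embedding dimension `3`, `τ ≥ 2`).
* `CampaignW46.HostTauTwoChainState.exists_next` — THE STEP: if `⟨J₀, E₀, m⟩` has NO marked resolution, blowing up the bad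
  point (B-permissible: a point has simple normal crossings with any SNC boundary; the new boundary is SNC again) leaves a
  near point (else the support of the transform is empty — a resolution), so `τ = 2`; the near point is unique, closed, of
  order `m`, embedding dimension `3`, `τ ≥ 2` (CP2008 Lemma 4.3) — a new stage.
* `CampaignW46.exists_isMarkedResolution_of_isolated_two_le_tau` — **HOST SHAPE**: `X` regular locally Noetherian, `E` an SNC
  boundary, `J`, `m ≥ 1`; if the points of order `≥ m` reduce to ONE closed point `x` with `ord_x J = m`, embedding dimension
  `3`, `τ_x(J, m) ≥ 2` and `𝒪_{X,x}` a G-ring, then `(X, J, E, m)` HAS A BGMW MARKED RESOLUTION (by successive point blow-ups;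
  were there none, the steps would give an infinite `τ = 2` near chain over the isolated point `x` of `Σ` — impossible by
  `false_of_nearChain_tau_two`).
* `CampaignW46.hostItem_isolated_two_le_tau_slice` — stmt-16156's binders VERBATIM plus «the order-`m` locus is one closed point
  of embedding dimension `3` with `τ ≥ 2`» ⇒ stmt-16156's conclusion VERBATIM, for EVERY SNC boundary `E`; the G-ring
  hypothesis is DISCHARGED (finite type over a field, Matsumura Cor. 32.6, tree).

HONEST VALUE. A partial result on the calibration item's LITERAL conclusion with non-monomial, characteristic-free content
beyond one blow-up: every threefold hypersurface input whose order-`m` locus is a single `τ ≥ 2` point (e.g. an isolated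
`A_k` double point `xy + z^{k+1}`, any `p`, any SNC boundary through it) is resolved in the host's sense, and the number of
blow-ups needed is finite BY PROOF (not by inspection). Nothing about `τ = 1` or positive-dimensional order-`m` loci.

References: `…ThreefoldsTauTwoSlice.lean` (p515229: plumbing `spanFinrank_maximalIdeal_congr`, `stalkTau_congr`,
`isGRing_stalk_congr`, `isRegular_subscheme_vanishingIdeal_singleton`, `exists_rsop_three`), `…ThreefoldsHostTauThreeSlice.lean` (p510668), `…ThreefoldsHostPowers.lean` (p506151:
`IsMultipleBlowup.isRegular_stages`), tree `Resolution/NearPointsPointCentreUnique.lean` (p514195), `NearChainTermination.lean`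
[CossartPiltant2008, proof of Prop. 4.4], `BlowupSNC.lean` (`MarkedIdeal.hasSNC_transform_boundary` [BierstoneGrigorievMilmanWlodarczyk2011,
Def. 3.1.3]), `MarkedResolutions.lean` (`IsMultipleBlowup.isLocallyNoetherian`), `MarkedIdeals.lean` (`IsMarkedResolution`),
`AlterationsNormalFormCentreFormalIdeal.lean` (`isGRing_stalk_of_polynomial`) + `WeakJacobianMizutaniProof.lean`
(`Matsumura1987_32_polynomial_holds` [Matsumura1987, §32, Cor. of Thm. 32.6]).
H. Hironaka, ms. 2017-03-23 — scope only, under adjudication, not cited as fact. [Hironaka2017]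
-/

noncomputable section

set_option linter.dupNamespace false -- mandated namespace of this single-conjunct summit

open CategoryTheory AlgebraicGeometry TopologicalSpace IsLocalRing

namespace Summit.ResolutionOfSingularities.ResolutionOfSingularities.Theorems

namespace CampaignW46

open Literature.AlgebraicGeometry.Resolution
open Scheme.IdealSheafData

universe u

/-! ## §0 A closed point is a B-permissible centre for every SNC boundary -/

/-- **A closed point has simple normal crossings with every simple-normal-crossings boundary** (singleton case of
`hasSNCWith_vanishingIdeal_finite_of_hasSNC`, p510668). [cite: BierstoneGrigorievMilmanWlodarczyk2011, Def. 3.1.3 (2)] -/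
theorem hasSNCWith_vanishingIdeal_singleton_of_hasSNC {X : Scheme.{u}} {E : List X.IdealSheafData} (hE : HasSNC E)
    {x : X} (hx : IsClosed ({x} : Set X)) : HasSNCWith E (vanishingIdeal ⟨{x}, hx⟩) :=
  hasSNCWith_vanishingIdeal_finite_of_hasSNC hE (Set.finite_singleton x) fun y hy => by
    rw [Set.mem_singleton_iff.mp hy]; exact hx

/-! ## §1 The chain state in BGMW currency (proof device) -/

/-- PROOF DEVICE (not an OURS notion, no role of the manuscript): **a stage of the chain of B-permissible point blow-ups
over an isolated `τ ≥ 2` point, host currency.** Over the fixed marked ideal `M₀ = (X₀, J₀, E₀, m)`: a scheme `X` (locally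
Noetherian, regular) with a BGMW multiple blow-up `Φ : X ⟶ X₀` of `M₀` ending in `(J, E, m)`, `E` with simple normal
crossings, and a CLOSED point `x ∈ X` which is the ONLY point of order `≥ m`, with `ord_x J = m`, embedding dimension `3`,
`τ_x(J, m) ≥ 2`. [cite: CossartPiltant2008, proof of Prop. 4.4] -/
structure HostTauTwoChainState (X₀ : Scheme.{u}) (M₀ : MarkedIdeal X₀) where
  /-- the stage `X_n` -/
  X : Scheme.{u}
  /-- the transform `J_n` -/
  J : X.IdealSheafData
  /-- the boundary `E_n` -/
  E : List X.IdealSheafData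
  /-- the bad point `x_n` -/
  x : X
  /-- the structure morphism `X_n ⟶ X_0` -/
  Φ : X ⟶ X₀
  /-- `X_n` is locally Noetherian -/
  locNoeth : IsLocallyNoetherian X
  /-- `X_n` is regular -/
  reg : Scheme.IsRegular X
  /-- `Φ` is a BGMW multiple blow-up of `M₀` ending in `(J_n, E_n, m)` -/
  mb : IsMultipleBlowup M₀ Φ ⟨J, E, M₀.mult⟩
  /-- the boundary has simple normal crossings -/
  snc : HasSNC E
  /-- `x_n` is a closed point -/
  closed : IsClosed ({x} : Set X)
  /-- `x_n` is the only point of order `≥ m` -/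
  bad : ∀ z : X, (M₀.mult : ℕ∞) ≤ idealOrder J z → z = x
  /-- `ord_{x_n} J_n = m` -/
  ord : idealOrder J x = M₀.mult
  /-- embedding dimension `3` at `x_n` -/
  dim : (maximalIdeal (X.presheaf.stalk x)).spanFinrank = 3
  /-- `τ(x_n) ≥ 2` -/
  tau : haveI := reg x; 2 ≤ stalkTau J x M₀.mult

namespace HostTauTwoChainState

variable {X₀ : Scheme.{u}} [IsLocallyNoetherian X₀] {M₀ : MarkedIdeal X₀}

set_option maxHeartbeats 800000 in
-- one long assembly of the near-point theory at the new stage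
/-- **THE STEP, HOST CURRENCY.** `X₀` regular locally Noetherian, `m ≥ 1`, and `M₀` WITHOUT a marked resolution. For a stage
`σ`, the blowing up `π : X′ ⟶ X_n` of the bad point is B-permissible (regular centre inside the support, simple normal crossings
with `E_n`), its boundary transform has simple normal crossings, and some point `x′` over `x_n` is near (otherwise the support
of the transform is empty and `π ≫ Φ` is a marked resolution of `M₀`); so `τ(x_n) = 2`, and the near point is unique, closed, of
order `m`, embedding dimension `3`, `τ ≥ 2` (CP2008 Lemma 4.3): a new stage. [cite: CossartPiltant2008, Lemma 4.3; proof of Prop. 4.4] -/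
theorem exists_next (hX₀ : Scheme.IsRegular X₀) (hm : 1 ≤ M₀.mult)
    (hnot : ¬ ∃ (X' : Scheme.{u}) (Φ : X' ⟶ X₀) (M' : MarkedIdeal X'), IsMarkedResolution M₀ Φ M')
    (σ : HostTauTwoChainState X₀ M₀) :
    ∃ (σ' : HostTauTwoChainState X₀ M₀) (π : σ'.X ⟶ σ.X),
      IsBlowup π (vanishingIdeal ⟨{σ.x}, σ.closed⟩) ∧
      σ'.J = controlledTransform π (vanishingIdeal ⟨{σ.x}, σ.closed⟩) σ.J M₀.mult ∧
      π σ'.x = σ.x ∧ IsNear π (vanishingIdeal ⟨{σ.x}, σ.closed⟩) σ.J M₀.mult σ'.x ∧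
      (haveI := σ.reg σ.x; stalkTau σ.J σ.x M₀.mult = 2) := by
  classical
  haveI : IsLocallyNoetherian σ.X := σ.locNoeth
  have hX : Scheme.IsRegular σ.X := σ.reg
  set m := M₀.mult with hmdef
  set D : Closeds σ.X := ⟨{σ.x}, σ.closed⟩ with hDdef
  have hreg : Scheme.IsRegular (vanishingIdeal D).subscheme := isRegular_subscheme_vanishingIdeal_singleton σ.closed
  have hY : ∀ y ∈ (D : Set σ.X), idealOrder σ.J y = m := fun y hy => by
    have hy' : y = σ.x := hy
    rw [hy']; exact σ.ord
  have hsupp : ((vanishingIdeal D).support : Set σ.X) ⊆ (⟨σ.J, σ.E, m⟩ : MarkedIdeal σ.X).support := by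
    intro y hy
    rw [Scheme.IdealSheafData.coe_support_vanishingIdeal] at hy
    exact (hY y hy).ge
  have hsnc : HasSNCWith (⟨σ.J, σ.E, m⟩ : MarkedIdeal σ.X).boundary (vanishingIdeal D) :=
    hasSNCWith_vanishingIdeal_singleton_of_hasSNC σ.snc σ.closed
  -- the B-permissible blowing up of the point and the next stage of the multiple blow-up
  obtain ⟨X', π, hπ⟩ := exists_isBlowup σ.X (vanishingIdeal D)
  have hmb' : IsMultipleBlowup M₀ (π ≫ σ.Φ) ((⟨σ.J, σ.E, m⟩ : MarkedIdeal σ.X).transform π (vanishingIdeal D)) :=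
    σ.mb.blowup (vanishingIdeal D) π hπ hreg hsupp hsnc
  haveI hN' : IsLocallyNoetherian X' := hmb'.isLocallyNoetherian
  have hR' : Scheme.IsRegular X' := IsMultipleBlowup.isRegular_stages hX₀ hmb'
  have hsnc' : HasSNC ((⟨σ.J, σ.E, m⟩ : MarkedIdeal σ.X).transform π (vanishingIdeal D)).boundary :=
    MarkedIdeal.hasSNC_transform_boundary _ hsnc hπ
  set J' := controlledTransform π (vanishingIdeal D) σ.J m with hJ'def
  -- off the fibre of `x_n` the order is `< m`
  have hoff : ∀ z : X', π z ≠ σ.x → ¬ (m : ℕ∞) ≤ idealOrder J' z := by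
    intro z hπz hz
    have hz' : π z ∉ ((vanishingIdeal D).support : Set σ.X) := by
      rw [Scheme.IdealSheafData.coe_support_vanishingIdeal]; exact hπz
    rw [hJ'def, hπ.idealOrder_controlledTransform_of_not_mem σ.J m hz'] at hz
    exact hπz (σ.bad (π z) hz)
  -- points over `x_n` of order `≥ m` are near
  have hnear_of : ∀ z : X', π z = σ.x → (m : ℕ∞) ≤ idealOrder J' z → IsNear π (vanishingIdeal D) σ.J m z := by
    intro z hπz hz
    have hle := hπ.idealOrder_controlledTransform_le_of_mem hX hreg hY (x' := z) (by rw [hπz]; rfl)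
    exact isNear_iff.mpr (le_antisymm hle hz)
  -- a near point exists, or the transform has empty support: a marked resolution
  have hex : ∃ x' : X', π x' = σ.x ∧ IsNear π (vanishingIdeal D) σ.J m x' := by
    by_contra hne
    push Not at hne
    refine hnot ⟨X', π ≫ σ.Φ, _, hmb', ?_⟩
    ext z
    simp only [Set.mem_empty_iff_false, iff_false]
    change ¬ ((m : ℕ∞) ≤ idealOrder J' z)
    intro hz
    by_cases hπz : π z = σ.x
    · exact hne z hπz (hnear_of z hπz hz)
    · exact hoff z hπz hz
  obtain ⟨x', hx', hnear⟩ := hex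
  -- the data at `x_n`, read at the point `π x'`
  haveI : IsRegularLocalRing (σ.X.presheaf.stalk (π x')) := hX (π x')
  haveI : IsRegularLocalRing (X'.presheaf.stalk x') := hR' x'
  have hcl : IsClosed ({π x'} : Set σ.X) := by rw [hx']; exact σ.closed
  have hDeq : D = ⟨{π x'}, hcl⟩ := Closeds.ext (by rw [hDdef]; simp [hx'])
  have hd : (maximalIdeal (σ.X.presheaf.stalk (π x'))).spanFinrank = 3 := by
    rw [spanFinrank_maximalIdeal_congr hx']; exact σ.dim
  obtain ⟨c, hc, hcY⟩ := exists_rsop_three hcl hd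
  rw [← hDeq] at hcY
  have hτ2 : 2 ≤ stalkTau σ.J (π x') m := by
    have h := σ.tau
    rwa [← stalkTau_congr hX σ.J m hx'] at h
  have hτ : stalkTau σ.J (π x') m = 2 :=
    le_antisymm (hπ.stalkTau_le_two_of_isNear_point hd hc hcY hnear) hτ2
  -- the invariants at the near point
  have hclosed' : IsClosed ({x'} : Set X') :=
    hπ.isClosed_singleton_of_isNear_point hX hR' hreg hY hcl hd hc hcY hτ hnear
  have hdim' : (maximalIdeal (X'.presheaf.stalk x')).spanFinrank = 3 :=
    hπ.spanFinrank_eq_three_of_isNear_point hd hc hcY hτ hnear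
  have htau' : 2 ≤ stalkTau J' x' m := by
    have h := hπ.stalkTau_le_stalkTau_of_isNear_point hm hd hc hcY hτ hnear
    rwa [hτ] at h
  have hbad' : ∀ z : X', (m : ℕ∞) ≤ idealOrder J' z → z = x' := by
    intro z hz
    by_cases hπz : π z = σ.x
    · exact hπ.eq_of_isNear_of_isNear_point hd hc hcY hτ hnear (hnear_of z hπz hz) (hπz.trans hx'.symm)
    · exact absurd hz (hoff z hπz)
  refine ⟨⟨X', J', ((⟨σ.J, σ.E, m⟩ : MarkedIdeal σ.X).transform π (vanishingIdeal D)).boundary, x', π ≫ σ.Φ, hN',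
    hR', hmb', hsnc', hclosed', hbad', isNear_iff.mp hnear, hdim', htau'⟩, π, hπ, rfl, hx', hnear, ?_⟩
  rw [stalkTau_congr hX σ.J m hx'.symm]; exact hτ

end HostTauTwoChainState

/-! ## §2 The isolated `τ ≥ 2` point, host shape -/

set_option maxHeartbeats 800000 in
-- the chain hypotheses of `false_of_nearChain_tau_two` are many; each is a transport along `π_n x_{n+1} = x_n`
/-- **THE ISOLATED `τ ≥ 2` POINT, HOST SHAPE.** `X` regular locally Noetherian, `E` a simple-normal-crossings boundary, `J` an
ideal sheaf, `m ≥ 1`; suppose the points of order `≥ m` reduce to ONE closed point `x` with `ord_x J = m`, embedding dimension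
`3`, Hironaka `τ_x(J, m) ≥ 2`, and `𝒪_{X,x}` a G-ring. Then the marked ideal `(X, J, E, m)` HAS A BGMW MARKED RESOLUTION (a
finite sequence of B-permissible point blow-ups emptying the support). Proof by contradiction: otherwise the steps
`HostTauTwoChainState.exists_next` give an infinite chain of `τ = 2` near points over `x`, an isolated point of `Σ`, against
`false_of_nearChain_tau_two`. [cite: CossartPiltant2008, proof of Prop. 4.4] -/
theorem exists_isMarkedResolution_of_isolated_two_le_tau {X : Scheme.{u}} [IsLocallyNoetherian X]
    (hX : Scheme.IsRegular X) (J : X.IdealSheafData) (E : List X.IdealSheafData) (hE : HasSNC E) {m : ℕ} (hm : 1 ≤ m)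
    (x : X) (hcl : IsClosed ({x} : Set X)) (hbad : ∀ z : X, (m : ℕ∞) ≤ idealOrder J z → z = x)
    (hord : idealOrder J x = m) (hdim : (maximalIdeal (X.presheaf.stalk x)).spanFinrank = 3)
    (hτ : haveI := hX x; 2 ≤ stalkTau J x m) (hG : IsGRing (X.presheaf.stalk x)) :
    ∃ (X' : Scheme.{u}) (Φ : X' ⟶ X) (M' : MarkedIdeal X'), IsMarkedResolution (⟨J, E, m⟩ : MarkedIdeal X) Φ M' := by
  classical
  by_contra hnot
  -- the initial stage
  let σ₀ : HostTauTwoChainState X ⟨J, E, m⟩ :=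
    ⟨X, J, E, x, 𝟙 X, inferInstance, hX, IsMultipleBlowup.refl _, hE, hcl, hbad, hord, hdim, hτ⟩
  -- the chain
  choose next πn hπn hJn hxn hnearn hτn using HostTauTwoChainState.exists_next (M₀ := ⟨J, E, m⟩) hX hm hnot
  let chain : ℕ → HostTauTwoChainState X ⟨J, E, m⟩ := fun n => Nat.rec σ₀ (fun _ σ => next σ) n
  let Xs : ℕ → Scheme.{u} := fun n => (chain n).X
  let π : ∀ n, Xs (n + 1) ⟶ Xs n := fun n => πn (chain n)
  let y : ∀ n, Xs (n + 1) := fun n => (chain (n + 1)).x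
  let Js : ∀ n, (Xs n).IdealSheafData := fun n => (chain n).J
  haveI : ∀ n, IsLocallyNoetherian (Xs n) := fun n => (chain n).locNoeth
  have e : ∀ n, π n (y n) = (chain n).x := fun n => hxn (chain n)
  have hy : ∀ n, π (n + 1) (y (n + 1)) = y n := fun n => e (n + 1)
  have hcls : ∀ n, IsClosed ({π n (y n)} : Set (Xs n)) := fun n => by rw [e n]; exact (chain n).closed
  have hC : ∀ n, (⟨{π n (y n)}, hcls n⟩ : Closeds (Xs n)) = ⟨{(chain n).x}, (chain n).closed⟩ := fun n =>
    Closeds.ext (by simp [e n])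
  have hregb : ∀ n, IsRegularLocalRing ((Xs n).presheaf.stalk (π n (y n))) := fun n => (chain n).reg _
  have hreg : ∀ n, IsRegularLocalRing ((Xs (n + 1)).presheaf.stalk (y n)) := fun n => (chain (n + 1)).reg _
  refine false_of_nearChain_tau_two Xs π y Js hm hy hcls (fun n => ?_) hregb hreg (fun n => ?_) (fun n => ?_)
    (fun n => ?_) (fun n => ?_) (fun n => ?_) ?_ ?_ ?_
  · rw [hC n]; exact hπn (chain n)
  · rw [spanFinrank_maximalIdeal_congr (e n)]; exact (chain n).dim
  · rw [hC n]; exact hJn (chain n)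
  · rw [hC n]; exact hnearn (chain n)
  · have h := hτn (chain n)
    rw [← stalkTau_congr (chain n).reg (chain n).J m (e n)] at h
    exact h
  · exact hτn (chain (n + 1))
  · rw [← le_idealOrder_iff]
    have h0 : idealOrder (Js 0) ((chain 0).x) = m := hord
    rw [e 0, h0]
  · exact isGRing_stalk_congr (e 0).symm hG
  · intro 𝔮 _ h𝔮
    refine not_map_le_pow_of_isolated (Js 0) (π 0 (y 0)) m (fun ζ hζ hne hle => ?_) 𝔮 h𝔮
    rw [e 0] at hζ hne
    exact hne (hbad ζ hle)

/-- The same for `X` locally of finite type over a field: NO G-ring hypothesis (Matsumura, Cor. of Thm. 32.6, tree).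
[cite: CossartPiltant2008, proof of Prop. 4.4; Matsumura1987, §32] -/
theorem exists_isMarkedResolution_of_isolated_two_le_tau_of_locallyOfFiniteType {k : Type u} [Field k]
    {X : Scheme.{u}} (s : X ⟶ Spec (.of k)) [LocallyOfFiniteType s] (hX : Scheme.IsRegular X)
    (J : X.IdealSheafData) (E : List X.IdealSheafData) (hE : HasSNC E) {m : ℕ} (hm : 1 ≤ m) (x : X)
    (hcl : IsClosed ({x} : Set X)) (hbad : ∀ z : X, (m : ℕ∞) ≤ idealOrder J z → z = x) (hord : idealOrder J x = m)
    (hdim : (maximalIdeal (X.presheaf.stalk x)).spanFinrank = 3) (hτ : haveI := hX x; 2 ≤ stalkTau J x m) :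
    ∃ (X' : Scheme.{u}) (Φ : X' ⟶ X) (M' : MarkedIdeal X'), IsMarkedResolution (⟨J, E, m⟩ : MarkedIdeal X) Φ M' := by
  haveI : IsLocallyNoetherian X := LocallyOfFiniteType.isLocallyNoetherian s
  exact exists_isMarkedResolution_of_isolated_two_le_tau hX J E hE hm x hcl hbad hord hdim hτ
    (isGRing_stalk_of_polynomial Matsumura1987_32_polynomial_holds s x)

/-! ## §3 stmt-16156's binders verbatim -/

/-- **THE ISOLATED `τ ≥ 2` POINT OF THE HOST ITEM stmt-16156, binders VERBATIM** (universe-polymorphic) plus the slice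
hypothesis «the points of order `≥ m` reduce to one closed point `x` with `ord_x I = m`, embedding dimension `3` and `τ ≥ 2`»
⇒ stmt-16156's CONCLUSION VERBATIM, for EVERY simple-normal-crossings boundary `E` — unconditionally (the G-ring hypothesis of
the termination argument is discharged for schemes of finite type over a field).
[cite: CossartPiltant2008, proof of Prop. 4.4; Matsumura1987, §32] -/
theorem hostItem_isolated_two_le_tau_slice :
    ∀ p : ℕ, p.Prime → ∀ (k : Type u) [Field k] [CharP k p] [PerfectField k] (X : Scheme.{u}) (s : X ⟶ Spec (.of k)),
      IsSeparated s → LocallyOfFiniteType s → QuasiCompact s → IsIntegral X → ∀ (hreg : Scheme.IsRegular X),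
        topologicalKrullDim X ≤ 3 → ∀ (I : X.IdealSheafData), I ≠ ⊥ → IsEffectiveCartier I →
          ∀ (E : List X.IdealSheafData), HasSNC E → ∀ (m : ℕ), 1 ≤ m →
            ∀ (x : X), IsClosed ({x} : Set X) → (∀ z : X, (m : ℕ∞) ≤ idealOrder I z → z = x) → idealOrder I x = m →
              (maximalIdeal (X.presheaf.stalk x)).spanFinrank = 3 → (haveI := hreg x; 2 ≤ stalkTau I x m) →
                ∃ (X' : Scheme.{u}) (Φ : X' ⟶ X) (M' : MarkedIdeal X'),
                  IsMarkedResolution (⟨I, E, m⟩ : MarkedIdeal X) Φ M' := by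
  intro _ _ k _ _ _ X s _ hloft _ _ hreg _ I _ _ E hE m hm x hcl hbad hord hdim hτ
  exact exists_isMarkedResolution_of_isolated_two_le_tau_of_locallyOfFiniteType s hreg I E hE hm x hcl hbad hord hdim hτ

end CampaignW46

end Summit.ResolutionOfSingularities.ResolutionOfSingularities.Theorems

end
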